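import Summits.NavierStokesRegularity.FunctionalMining.StretchingLaminateRecord5P2
import HarnessLib

/-!
# K1-Q1 laminates: bank hub-policy tree `treeH14` (hub14_full_cert.json; 8677 splits, r = 13613/20000), kernel pieces,
part P3

Dict seat g20, staged 2026-08-21T16:50:53Z. NS FUNCTIONAL MINING cell (`pub-nsfunc`), dictionary
seat gen 20 — **search for candidate a priori estimates; no regularity claim.** STATIC field
inequalities only: nothing about Navier–Stokes solutions is asserted anywhere in this file.

This file holds KERNEL PIECES of the split certificate (prove g14 PORT-NOTES §3): for frontier
positions of the tree `treeH14` (path letters P = `+` child, M = `−` child from the root), the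
production `Tree.stretchFrom`, enstrophy `Tree.energyFrom` and vorticity ceiling `Tree.vortSupFrom`
of the sub-laminate below that position, evaluated by `decide +kernel` from the UNEVALUATED incoming
state (nested `Grad.layer … Grad.zero`, weights as products of the named root splits `treeH14_r…` of
`…Record5Asm`-independent constants defined here) — each its own declaration, hence its own kernel
budget (one whole-tree `decide` exceeds the per-declaration cap measured by prove g14: ≈ 4.3k node
visits). Values are exact rationals computed by `port5/gen5.py` with the `Laminate.Tree` semantics
and re-derived from the bank JSON. [ours; bookkeeping]
-/

namespace Summit.NavierStokesRegularity.FunctionalMining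

namespace Laminate

/-- kernel piece: production below frontier position `PMM` (2168 splits). [ours; computation] -/
theorem treeH14_sfPMM :
    Tree.stretchFrom (Grad.layer (Grad.layer (Grad.layer Grad.zero (1 - treeH14_r0.lam) treeH14_r0)
      (-treeH14_rP.lam) treeH14_rP) (-treeH14_rPM.lam) treeH14_rPM) (1 * treeH14_r0.lam * (1 -
      treeH14_rP.lam) * (1 - treeH14_rPM.lam)) treeH14_s984 =
      ((239846733503979336192974218081858701796958081737503385115031956697511191737205785256592991344124474086149449961759267741019943
      : ℚ) /
      4020190110100034071306393151093494707351924754561723155312602548573877362820812135513204310655055451206862926483154296875000000) := by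
  decide +kernel

/-- kernel piece: enstrophy below frontier position `PMM`. [ours; computation] -/
theorem treeH14_efPMM :
    Tree.energyFrom (Grad.layer (Grad.layer (Grad.layer Grad.zero (1 - treeH14_r0.lam) treeH14_r0)
      (-treeH14_rP.lam) treeH14_rP) (-treeH14_rPM.lam) treeH14_rPM) (1 * treeH14_r0.lam * (1 -
      treeH14_rP.lam) * (1 - treeH14_rPM.lam)) treeH14_s984 = ((75 : ℚ) / 896) := by
  decide +kernel

/-- kernel piece: vorticity ceiling below frontier position `PMM`. [ours; computation] -/
theorem treeH14_vfPMM :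
    Tree.vortSupFrom (Grad.layer (Grad.layer (Grad.layer Grad.zero (1 - treeH14_r0.lam) treeH14_r0)
      (-treeH14_rP.lam) treeH14_rP) (-treeH14_rPM.lam) treeH14_rPM) treeH14_s984 = (1 : ℚ) := by
  decide +kernel

end Laminate

end Summit.NavierStokesRegularity.FunctionalMining

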